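import Literature.NumberTheory.LFunctions.RiemannSiegelStirling
import Literature.NumberTheory.LFunctions.KeiperLiTrend
import Literature.NumberTheory.LFunctions.ZetaZeroSumsLehmanExplicit
import HarnessLib

/-!
# RH-FREE — Third-order Stirling for the Riemann–Siegel theta function and the DISCHARGE of Brent–Platt–Trudgian 2021, Lemma 2: `|Q(t) − S(t)| ≤ 1/(150t)` for all `t ≥ 2π` («nothing here bears on the truth of RH»)

Topic `Literature/NumberTheory/LFunctions` (RH literature-typing tranche 1, L4 "explicit zero
statistics", gen 7). Label: **RH-FREE**. THEOREMS only — NO definition, NO new named fact (D-0026);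
the last theorem is `BrentPlattTrudgian2021_lemma2_holds : BrentPlattTrudgian2021_lemma2`, the discharge of
the named fact of `ZetaZeroSumsLehmanExplicit.lean` ("If `Q(t)` and `S(t)` are defined as above then, for
all `t ≥ 2π`, `|Q(t) − S(t)| ≤ 1/(150t)`", Brent–Platt–Trudgian, Math. Comp. 90 (2021), Lemma 2, whose
printed proof uses Brent's explicit remainder for three terms of Stirling's series of `θ`). Nothing here
bears on the truth of RH.

Method (continuing `RiemannSiegelStirlingSecondOrder.lean`): `θ(t) − ((t/2)log(t/2π) − t/2 − π/8) =
−∫_{t/2}^∞ (Re ψ(¼+iu) − log u) du` (the tree's `argGammaVert`/`stirlingArgConst` machinery), and the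
integrand is expanded to THIRD order with the tree's explicit Stirling series for `ψ` of order `ν = 5`
(`Literature.Analysis.SpecialFunctions.Complex.norm_digamma_sub_stirlingSeries_le`):

* `norm_digamma_sub_stirling_ten_le` — `‖ψ(w) − Log w + 1/(2w) + 1/(12w²) − 1/(120w⁴) + 1/(252w⁶)
  − 1/(240w⁸) + 1/(132w¹⁰)‖ ≤ 51975/(8π⁹‖w‖¹⁰ Re w)` (`B₆ = 1/42`, `B₈ = −1/30`, `B₁₀ = 5/66`).
* `abs_re_digamma_vertical_sub_log_sub_sub_le` — for `0 < σ ≤ ½`, `u ≥ 1`: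
  `|Re ψ(σ+iu) − log u − a(σ)/u² − b(σ)/u⁴| ≤ K₆(σ)/u⁶ + (1/240)/u⁸ + K₁₀(σ)/u¹⁰` with
  `a = σ²/2 − σ/2 + 1/12`, `b = −σ⁴/4 + σ³/2 − σ²/4 + 1/120`,
  `K₆ = σ⁶ + σ⁵/2 + (5σ⁴+3σ⁶)/12 + (10σ²+5σ⁴+4σ⁶+σ⁸)/120 + 1/252`, `K₁₀ = 1/132 + 51975/(8π⁹σ)`
  (exact real parts `Re 1/(2w) = σ/(2N)`, `Re 1/(12w²) = (σ²−u²)/(12N²)`, `Re 1/(120w⁴) = (u⁴−6σ²u²+σ⁴)/(120N⁴)`,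
  `N = σ²+u²`, against their expansions; `½ log(1+σ²/u²)` by Mathlib's `Real.abs_log_sub_add_sum_range_le`).
* `abs_argGammaVert_sub_stirling_three_le` — `|arg Γ(σ+iτ) − (τ log τ − τ) − c(σ) + a/τ + b/(3τ³)| ≤
  K₆/(5τ⁵) + (1/240)/(7τ⁷) + K₁₀/(9τ⁹)` (`τ ≥ 1`).
* `abs_riemannSiegelTheta_sub_stirling_three_le` — **`|θ(t) − ((t/2)log(t/2π) − t/2 − π/8 + 1/(48t) + 7/(5760t³))|
  ≤ 0.0754/t⁵ + 0.0762/t⁷ + 50.03/t⁹`** for `t ≥ 2` (`a(¼) = −1/96`, `b(¼) = −7/15360`).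
* `BrentPlattTrudgian2021_lemma2_holds` — for `t ≥ 2π` the right side plus `7/(5760t³)` is below
  `(π/150 − 1/48)/t` (margin `≈ 1·10⁻⁵/t` at `t = 2π`), so `|θ − main| ≤ π/(150t)` and
  **`|Q(t) − S(t)| ≤ 1/(150t)`**: the named fact `BrentPlattTrudgian2021_lemma2` is a theorem.

## References

* R. P. Brent, D. J. Platt, T. S. Trudgian, Math. Comp. 90 (2021) 2923–2935, Lemma 2. [BrentPlattTrudgian2021]
* G. E. Andrews, R. Askey, R. Roy, *Special Functions* (1999), Cor. 1.4.5. [AndrewsAskeyRoy1999]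
* M. Abramowitz, I. A. Stegun, *Handbook of Mathematical Functions* (1964), Table 23.2 (`B₆, B₈, B₁₀`). [AbramowitzStegun1964]
-/

noncomputable section

open Complex Real Set Filter Topology MeasureTheory intervalIntegral

namespace Literature.NumberTheory.LFunctions

open SchoenfeldBound

/-! ### Bernoulli numbers `B₆, B₈, B₁₀` -/

/-- `B'_5 = 0`. [cite: AbramowitzStegun1964, Table 23.2] -/
private lemma bern5 : bernoulli' 5 = 0 := bernoulli'_eq_zero_of_odd (by decide) (by norm_num)

/-- `B'_6 = 1/42`. [cite: AbramowitzStegun1964, Table 23.2] -/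
private lemma bern6 : bernoulli' 6 = 1 / 42 := by
  rw [bernoulli'_def]
  norm_num [Finset.sum_range_succ, Nat.choose, bernoulli'_zero, bernoulli'_one, bernoulli'_two,
    bernoulli'_three, bernoulli'_four, bern5]

/-- `B'_7 = 0`. [cite: AbramowitzStegun1964, Table 23.2] -/
private lemma bern7 : bernoulli' 7 = 0 := bernoulli'_eq_zero_of_odd (by decide) (by norm_num)

/-- `B'_8 = −1/30`. [cite: AbramowitzStegun1964, Table 23.2] -/
private lemma bern8 : bernoulli' 8 = -1 / 30 := by
  rw [bernoulli'_def]
  norm_num [Finset.sum_range_succ, Nat.choose, bernoulli'_zero, bernoulli'_one, bernoulli'_two,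
    bernoulli'_three, bernoulli'_four, bern5, bern6, bern7]

/-- `B'_9 = 0`. [cite: AbramowitzStegun1964, Table 23.2] -/
private lemma bern9 : bernoulli' 9 = 0 := bernoulli'_eq_zero_of_odd (by decide) (by norm_num)

/-- `B'_10 = 5/66`. [cite: AbramowitzStegun1964, Table 23.2] -/
private lemma bern10 : bernoulli' 10 = 5 / 66 := by
  rw [bernoulli'_def]
  norm_num [Finset.sum_range_succ, Nat.choose, bernoulli'_zero, bernoulli'_one, bernoulli'_two,
    bernoulli'_three, bernoulli'_four, bern5, bern6, bern7, bern8, bern9]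

/-! ### Stirling's series for `ψ` to order `ν = 5` -/

/-- **Stirling for `ψ` with five Bernoulli terms** (`ν = 5` of `norm_digamma_sub_stirlingSeries_le`):
`‖ψ(w) − Log w + 1/(2w) + 1/(12w²) − 1/(120w⁴) + 1/(252w⁶) − 1/(240w⁸) + 1/(132w¹⁰)‖ ≤ 51975/(8π⁹ ‖w‖¹⁰ Re w)`
(`(π²/3)·11!/(2π)¹¹ = 51975/(8π⁹)`). [cite: AndrewsAskeyRoy1999, Cor 1.4.5] -/
theorem norm_digamma_sub_stirling_ten_le {w : ℂ} (hw : 0 < w.re) :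
    ‖Complex.digamma w - Complex.log w + 1 / (2 * w) + 1 / (12 * w ^ 2) - 1 / (120 * w ^ 4)
        + 1 / (252 * w ^ 6) - 1 / (240 * w ^ 8) + 1 / (132 * w ^ 10)‖ ≤
      51975 / (8 * π ^ 9) / (‖w‖ ^ 10 * w.re) := by
  have h := Literature.Analysis.SpecialFunctions.Complex.norm_digamma_sub_stirlingSeries_le hw
    (by norm_num : (5 : ℕ) ≠ 0)
  have hw0 : w ≠ 0 := fun h0 ↦ by rw [h0] at hw; simp at hw
  have hb2 : (bernoulli 2 : ℂ) = 1 / 6 := by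
    rw [bernoulli_eq_bernoulli'_of_ne_one (by norm_num), bernoulli'_two]; push_cast; ring
  have hb4 : (bernoulli 4 : ℂ) = -1 / 30 := by
    rw [bernoulli_eq_bernoulli'_of_ne_one (by norm_num), bernoulli'_four]; push_cast; ring
  have hb6 : (bernoulli 6 : ℂ) = 1 / 42 := by
    rw [bernoulli_eq_bernoulli'_of_ne_one (by norm_num), bern6]; push_cast; ring
  have hb8 : (bernoulli 8 : ℂ) = -1 / 30 := by
    rw [bernoulli_eq_bernoulli'_of_ne_one (by norm_num), bern8]; push_cast; ring
  have hb10 : (bernoulli 10 : ℂ) = 5 / 66 := by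
    rw [bernoulli_eq_bernoulli'_of_ne_one (by norm_num), bern10]; push_cast; ring
  rw [show Finset.Icc 1 5 = {1, 2, 3, 4, 5} by rfl, Finset.sum_insert (by decide),
    Finset.sum_insert (by decide), Finset.sum_insert (by decide), Finset.sum_pair (by norm_num)] at h
  simp only [Nat.mul_one, show 2 * 2 = 4 by rfl, show 2 * 3 = 6 by rfl, show 2 * 4 = 8 by rfl,
    show 2 * 5 = 10 by rfl, hb2, hb4, hb6, hb8, hb10, Nat.cast_one, Nat.cast_ofNat] at h
  have heq : Complex.digamma w - (Complex.log w - 1 / (2 * w) -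
      (1 / 6 / (2 * 1) / w ^ 2 + (-1 / 30 / (2 * 2) / w ^ 4 + (1 / 42 / (2 * 3) / w ^ 6
        + (-1 / 30 / (2 * 4) / w ^ 8 + 5 / 66 / (2 * 5) / w ^ 10))))) =
      Complex.digamma w - Complex.log w + 1 / (2 * w) + 1 / (12 * w ^ 2) - 1 / (120 * w ^ 4)
        + 1 / (252 * w ^ 6) - 1 / (240 * w ^ 8) + 1 / (132 * w ^ 10) := by
    field_simp; ring
  rw [heq] at h
  refine h.trans (le_of_eq ?_)
  simp only [Nat.factorial, Nat.succ_eq_add_one]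
  push_cast
  have hπ : Real.pi ≠ 0 := Real.pi_ne_zero
  field_simp
  ring

/-! ### The pointwise third-order bound for `Re ψ` on a vertical line -/

set_option maxHeartbeats 800000 in
/-- **Third-order Stirling for `Re ψ` on `Re w = σ ∈ (0, ½]`**: for `u ≥ 1`, with
`a = σ²/2 − σ/2 + 1/12`, `b = −σ⁴/4 + σ³/2 − σ²/4 + 1/120`,
`|Re ψ(σ+iu) − log u − a/u² − b/u⁴| ≤ K₆(σ)/u⁶ + (1/240)/u⁸ + K₁₀(σ)/u¹⁰`,
`K₆ = σ⁶ + σ⁵/2 + (5σ⁴+3σ⁶)/12 + (10σ²+5σ⁴+4σ⁶+σ⁸)/120 + 1/252`, `K₁₀ = 1/132 + 51975/(8π⁹σ)`.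
[cite: AndrewsAskeyRoy1999, Cor 1.4.5] -/
theorem abs_re_digamma_vertical_sub_log_sub_sub_le {σ u : ℝ} (hσ : 0 < σ) (hσ1 : σ ≤ 1 / 2) (hu : 1 ≤ u) :
    |(digamma (σ + u * I)).re - Real.log u - (σ ^ 2 / 2 - σ / 2 + 1 / 12) / u ^ 2
        - (-(σ ^ 4 / 4) + σ ^ 3 / 2 - σ ^ 2 / 4 + 1 / 120) / u ^ 4| ≤
      (σ ^ 6 + σ ^ 5 / 2 + (5 * σ ^ 4 + 3 * σ ^ 6) / 12 + (10 * σ ^ 2 + 5 * σ ^ 4 + 4 * σ ^ 6 + σ ^ 8) / 120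
          + 1 / 252) / u ^ 6
        + (1 / 240) / u ^ 8 + (1 / 132 + 51975 / (8 * π ^ 9 * σ)) / u ^ 10 := by
  set w : ℂ := σ + u * I with hw
  have hwre : w.re = σ := by simp [hw]
  have hwim : w.im = u := by simp [hw]
  have hu0 : 0 < u := by linarith
  set N : ℝ := σ ^ 2 + u ^ 2 with hN
  have hN0 : 0 < N := by positivity
  have hNu : u ^ 2 ≤ N := by rw [hN]; nlinarith
  -- norms
  have hnorm2 : ‖w‖ ^ 2 = N := by
    rw [Complex.sq_norm, Complex.normSq_apply, hwre, hwim, hN]; ring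
  have hnorm_ge : u ≤ ‖w‖ := by
    have := Complex.abs_im_le_norm w
    rwa [hwim, abs_of_pos hu0] at this
  have hnorm0 : 0 < ‖w‖ := hu0.trans_le hnorm_ge
  have hnormk : ∀ k : ℕ, u ^ k ≤ ‖w‖ ^ k := fun k ↦ pow_le_pow_left₀ hu0.le hnorm_ge k
  -- the Stirling remainder and its real part
  set R : ℂ := digamma w - Complex.log w + 1 / (2 * w) + 1 / (12 * w ^ 2) - 1 / (120 * w ^ 4)
    + 1 / (252 * w ^ 6) - 1 / (240 * w ^ 8) + 1 / (132 * w ^ 10) with hRdef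
  have hR : ‖R‖ ≤ 51975 / (8 * π ^ 9) / (‖w‖ ^ 10 * σ) := by
    have := norm_digamma_sub_stirling_ten_le (w := w) (by rw [hwre]; exact hσ)
    rwa [hwre] at this
  have hRre : |R.re| ≤ (51975 / (8 * π ^ 9 * σ)) / u ^ 10 := by
    calc |R.re| ≤ ‖R‖ := Complex.abs_re_le_norm R
      _ ≤ 51975 / (8 * π ^ 9) / (‖w‖ ^ 10 * σ) := hR
      _ ≤ 51975 / (8 * π ^ 9) / (u ^ 10 * σ) := by
          apply div_le_div_of_nonneg_left (by positivity) (by positivity)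
          exact mul_le_mul_of_nonneg_right (hnormk 10) hσ.le
      _ = (51975 / (8 * π ^ 9 * σ)) / u ^ 10 := by
          field_simp
  -- crude terms `F, G, H`
  have hcrude : ∀ (c : ℝ) (k : ℕ), 0 < c → |(1 / ((c : ℂ) * w ^ k)).re| ≤ 1 / (c * u ^ k) := by
    intro c k hc
    calc |(1 / ((c : ℂ) * w ^ k)).re| ≤ ‖1 / ((c : ℂ) * w ^ k)‖ := Complex.abs_re_le_norm _
      _ = 1 / (c * ‖w‖ ^ k) := by simp [norm_pow, abs_of_pos hc]
      _ ≤ 1 / (c * u ^ k) := by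
          apply div_le_div_of_nonneg_left (by norm_num) (by positivity)
          exact mul_le_mul_of_nonneg_left (hnormk k) hc.le
  have hF := hcrude 252 6 (by norm_num)
  have hG := hcrude 240 8 (by norm_num)
  have hH := hcrude 132 10 (by norm_num)
  -- A : `log ‖w‖ − log u = ½ log(1 + s)`, `s = σ²/u² ≤ 1/4`
  have hlogre : (Complex.log w).re = Real.log ‖w‖ := Complex.log_re w
  set s : ℝ := σ ^ 2 / u ^ 2 with hs
  have hs0 : 0 < s := by positivity
  have hs1 : s ≤ 1 / 4 := by
    rw [hs, div_le_iff₀ (by positivity)]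
    have hu2 : 1 ≤ u ^ 2 := by nlinarith
    nlinarith
  have hL : Real.log ‖w‖ - Real.log u = Real.log (1 + s) / 2 := by
    have h1 : Real.log (‖w‖ ^ 2) = 2 * Real.log ‖w‖ := by rw [Real.log_pow]; norm_num
    have h2 : Real.log (u ^ 2) = 2 * Real.log u := by rw [Real.log_pow]; norm_num
    have h3 : 1 + s = N / u ^ 2 := by rw [hs, hN]; field_simp; ring
    rw [h3, Real.log_div hN0.ne' (by positivity), ← hnorm2, h1, h2]
    ring
  have hA : |Real.log ‖w‖ - Real.log u - σ ^ 2 / (2 * u ^ 2) + σ ^ 4 / (4 * u ^ 4)| ≤ σ ^ 6 / u ^ 6 := by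
    have hT := Real.abs_log_sub_add_sum_range_le (show |(-s)| < 1 by
      rw [abs_neg, abs_of_pos hs0]; linarith) 2
    simp only [Finset.sum_range_succ, Finset.sum_range_zero, zero_add, abs_neg, abs_of_pos hs0,
      sub_neg_eq_add] at hT
    norm_num at hT
    -- hT : |-s + s ^ 2 / 2 + log (1 + s)| ≤ s ^ 3 / (1 - s)
    have hs3 : s ^ 3 / (1 - s) ≤ 2 * s ^ 3 := by
      rw [div_le_iff₀ (by linarith)]
      nlinarith [pow_pos hs0 3]
    have hT' := abs_le.1 (hT.trans hs3)
    have es1 : σ ^ 2 / (2 * u ^ 2) = s / 2 := by rw [hs]; ring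
    have es2 : σ ^ 4 / (4 * u ^ 4) = s ^ 2 / 4 := by rw [hs]; ring
    have es3 : σ ^ 6 / u ^ 6 = s ^ 3 := by rw [hs]; ring
    rw [hL, es1, es2, es3, abs_le]
    constructor <;> linarith [hT'.1, hT'.2]
  -- B : `Re 1/(2w) = σ/(2N)`; `δB = σ⁵/(2u⁴N) ∈ [0, σ⁵/(2u⁶)]`
  have hB : (1 / (2 * w)).re = σ / (2 * N) := by
    rw [one_div, Complex.inv_re, Complex.normSq_apply, hN]
    simp [hw]
    field_simp
  have hBd : (1 / (2 * w)).re - σ / (2 * u ^ 2) + σ ^ 3 / (2 * u ^ 4) = σ ^ 5 / (2 * u ^ 4 * N) := by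
    rw [hB, hN]
    field_simp
    ring
  have hB0 : 0 ≤ (1 / (2 * w)).re - σ / (2 * u ^ 2) + σ ^ 3 / (2 * u ^ 4) := by
    rw [hBd]; positivity
  have hB1 : (1 / (2 * w)).re - σ / (2 * u ^ 2) + σ ^ 3 / (2 * u ^ 4) ≤ σ ^ 5 / 2 / u ^ 6 := by
    rw [hBd, div_div]
    apply div_le_div_of_nonneg_left (by positivity) (by positivity)
    calc 2 * u ^ 6 = 2 * u ^ 4 * u ^ 2 := by ring
      _ ≤ 2 * u ^ 4 * N := by gcongr
  -- C : `Re 1/(12w²) = (σ² − u²)/(12N²)`; `δC = −(5σ⁴u² + 3σ⁶)/(12u⁴N²)`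
  set A : ℝ := σ ^ 2 - u ^ 2 with hA_def
  set B : ℝ := 2 * σ * u with hB_def
  have hw2 : w ^ 2 = (A : ℂ) + (B : ℂ) * I := by
    rw [hw, hA_def, hB_def]
    apply Complex.ext
    · simp [sq]
    · simp [sq]; ring
  have hAB : A ^ 2 + B ^ 2 = N ^ 2 := by rw [hA_def, hB_def, hN]; ring
  have hABne : A ^ 2 + B ^ 2 ≠ 0 := by rw [hAB]; positivity
  have hC : (1 / (12 * w ^ 2)).re = A / (12 * (A ^ 2 + B ^ 2)) := by
    rw [hw2, one_div, Complex.inv_re, Complex.normSq_apply]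
    have hre : ((12 : ℂ) * ((A : ℂ) + (B : ℂ) * I)).re = 12 * A := by simp
    have him : ((12 : ℂ) * ((A : ℂ) + (B : ℂ) * I)).im = 12 * B := by simp
    rw [hre, him]
    have hden : 12 * A * (12 * A) + 12 * B * (12 * B) = 144 * (A ^ 2 + B ^ 2) := by ring
    rw [hden]
    field_simp
    ring
  have hCd : (1 / (12 * w ^ 2)).re + 1 / (12 * u ^ 2) - σ ^ 2 / (4 * u ^ 4) =
      -((5 * σ ^ 4 * u ^ 2 + 3 * σ ^ 6) / (12 * u ^ 4 * N ^ 2)) := by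
    rw [hC, hAB, hA_def, hN]
    field_simp
    ring
  have hC1 : (1 / (12 * w ^ 2)).re + 1 / (12 * u ^ 2) - σ ^ 2 / (4 * u ^ 4) ≤ 0 := by
    rw [hCd, neg_nonpos]; positivity
  have hC0 : -((5 * σ ^ 4 + 3 * σ ^ 6) / 12 / u ^ 6) ≤
      (1 / (12 * w ^ 2)).re + 1 / (12 * u ^ 2) - σ ^ 2 / (4 * u ^ 4) := by
    rw [hCd, neg_le_neg_iff, div_div]
    have hN4 : u ^ 4 ≤ N ^ 2 := by
      calc u ^ 4 = (u ^ 2) ^ 2 := by ring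
        _ ≤ N ^ 2 := pow_le_pow_left₀ (by positivity) hNu 2
    have hu2 : 1 ≤ u ^ 2 := one_le_pow₀ hu
    calc (5 * σ ^ 4 * u ^ 2 + 3 * σ ^ 6) / (12 * u ^ 4 * N ^ 2)
        ≤ (5 * σ ^ 4 + 3 * σ ^ 6) * u ^ 2 / (12 * u ^ 4 * N ^ 2) := by
          apply div_le_div_of_nonneg_right _ (by positivity)
          have h36 : 3 * σ ^ 6 * 1 ≤ 3 * σ ^ 6 * u ^ 2 := mul_le_mul_of_nonneg_left hu2 (by positivity)
          linarith
      _ ≤ (5 * σ ^ 4 + 3 * σ ^ 6) * u ^ 2 / (12 * u ^ 4 * u ^ 4) := by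
          apply div_le_div_of_nonneg_left (by positivity) (by positivity)
          exact mul_le_mul_of_nonneg_left hN4 (by positivity)
      _ = (5 * σ ^ 4 + 3 * σ ^ 6) / (12 * u ^ 6) := by
          field_simp
  -- D : `Re 1/(120w⁴) = (A² − B²)/(120 N⁴)`, `A² − B² = u⁴ − 6σ²u² + σ⁴`
  set A₂ : ℝ := A ^ 2 - B ^ 2 with hA₂_def
  set B₂ : ℝ := 2 * A * B with hB₂_def
  have hw4 : w ^ 4 = (A₂ : ℂ) + (B₂ : ℂ) * I := by
    rw [show w ^ 4 = (w ^ 2) ^ 2 by ring, hw2, hA₂_def, hB₂_def]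
    apply Complex.ext
    · simp [sq]
    · simp [sq]; ring
  have hAB₂ : A₂ ^ 2 + B₂ ^ 2 = N ^ 4 := by
    rw [hA₂_def, hB₂_def, show N ^ 4 = (N ^ 2) ^ 2 by ring, ← hAB]; ring
  have hAB₂ne : A₂ ^ 2 + B₂ ^ 2 ≠ 0 := by rw [hAB₂]; positivity
  have hD : (1 / (120 * w ^ 4)).re = A₂ / (120 * (A₂ ^ 2 + B₂ ^ 2)) := by
    rw [hw4, one_div, Complex.inv_re, Complex.normSq_apply]
    have hre : ((120 : ℂ) * ((A₂ : ℂ) + (B₂ : ℂ) * I)).re = 120 * A₂ := by simp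
    have him : ((120 : ℂ) * ((A₂ : ℂ) + (B₂ : ℂ) * I)).im = 120 * B₂ := by simp
    rw [hre, him]
    have hden : 120 * A₂ * (120 * A₂) + 120 * B₂ * (120 * B₂) = 14400 * (A₂ ^ 2 + B₂ ^ 2) := by ring
    rw [hden]
    field_simp
    ring
  have hA₂val : A₂ = u ^ 4 - 6 * σ ^ 2 * u ^ 2 + σ ^ 4 := by rw [hA₂_def, hA_def, hB_def]; ring
  have hDd : (1 / (120 * w ^ 4)).re - 1 / (120 * u ^ 4) =
      -((10 * σ ^ 2 * u ^ 6 + 5 * σ ^ 4 * u ^ 4 + 4 * σ ^ 6 * u ^ 2 + σ ^ 8) / (120 * u ^ 4 * N ^ 4)) := by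
    rw [hD, hAB₂, hA₂val, hN]
    field_simp
    ring
  have hD1 : (1 / (120 * w ^ 4)).re - 1 / (120 * u ^ 4) ≤ 0 := by
    rw [hDd, neg_nonpos]; positivity
  have hD0 : -((10 * σ ^ 2 + 5 * σ ^ 4 + 4 * σ ^ 6 + σ ^ 8) / 120 / u ^ 6) ≤
      (1 / (120 * w ^ 4)).re - 1 / (120 * u ^ 4) := by
    rw [hDd, neg_le_neg_iff, div_div]
    have hu2 : 1 ≤ u ^ 2 := one_le_pow₀ hu
    have hu4 : 1 ≤ u ^ 4 := one_le_pow₀ hu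
    have hu06 : (1 : ℝ) ≤ u ^ 6 := one_le_pow₀ hu
    have hu46 : u ^ 4 ≤ u ^ 6 := by
      calc u ^ 4 = u ^ 4 * 1 := by ring
        _ ≤ u ^ 4 * u ^ 2 := by gcongr
        _ = u ^ 6 := by ring
    have hu26 : u ^ 2 ≤ u ^ 6 := by
      calc u ^ 2 = u ^ 2 * 1 := by ring
        _ ≤ u ^ 2 * u ^ 4 := by gcongr
        _ = u ^ 6 := by ring
    have hN8 : u ^ 8 ≤ N ^ 4 := by
      calc u ^ 8 = (u ^ 2) ^ 4 := by ring
        _ ≤ N ^ 4 := pow_le_pow_left₀ (by positivity) hNu 4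
    have hP : 10 * σ ^ 2 * u ^ 6 + 5 * σ ^ 4 * u ^ 4 + 4 * σ ^ 6 * u ^ 2 + σ ^ 8 ≤
        (10 * σ ^ 2 + 5 * σ ^ 4 + 4 * σ ^ 6 + σ ^ 8) * u ^ 6 := by
      have h1 := mul_le_mul_of_nonneg_left hu46 (by positivity : (0 : ℝ) ≤ 5 * σ ^ 4)
      have h2 := mul_le_mul_of_nonneg_left hu26 (by positivity : (0 : ℝ) ≤ 4 * σ ^ 6)
      have h3 := mul_le_mul_of_nonneg_left hu06 (by positivity : (0 : ℝ) ≤ σ ^ 8)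
      linarith
    calc (10 * σ ^ 2 * u ^ 6 + 5 * σ ^ 4 * u ^ 4 + 4 * σ ^ 6 * u ^ 2 + σ ^ 8) / (120 * u ^ 4 * N ^ 4)
        ≤ (10 * σ ^ 2 + 5 * σ ^ 4 + 4 * σ ^ 6 + σ ^ 8) * u ^ 6 / (120 * u ^ 4 * N ^ 4) :=
          div_le_div_of_nonneg_right hP (by positivity)
      _ ≤ (10 * σ ^ 2 + 5 * σ ^ 4 + 4 * σ ^ 6 + σ ^ 8) * u ^ 6 / (120 * u ^ 4 * u ^ 8) := by
          apply div_le_div_of_nonneg_left (by positivity) (by positivity)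
          exact mul_le_mul_of_nonneg_left hN8 (by positivity)
      _ = (10 * σ ^ 2 + 5 * σ ^ 4 + 4 * σ ^ 6 + σ ^ 8) / (120 * u ^ 6) := by
          field_simp
  -- assemble
  have hRre_eq : R.re = (digamma w).re - Real.log ‖w‖ + (1 / (2 * w)).re + (1 / (12 * w ^ 2)).re
      - (1 / (120 * w ^ 4)).re + (1 / ((252 : ℝ) * w ^ 6)).re - (1 / ((240 : ℝ) * w ^ 8)).re
      + (1 / ((132 : ℝ) * w ^ 10)).re := by
    simp only [hRdef, Complex.sub_re, Complex.add_re, hlogre]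
    push_cast
    ring
  have key : (digamma w).re - Real.log u - (σ ^ 2 / 2 - σ / 2 + 1 / 12) / u ^ 2
        - (-(σ ^ 4 / 4) + σ ^ 3 / 2 - σ ^ 2 / 4 + 1 / 120) / u ^ 4 =
      R.re + (Real.log ‖w‖ - Real.log u - σ ^ 2 / (2 * u ^ 2) + σ ^ 4 / (4 * u ^ 4))
        - ((1 / (2 * w)).re - σ / (2 * u ^ 2) + σ ^ 3 / (2 * u ^ 4))
        - ((1 / (12 * w ^ 2)).re + 1 / (12 * u ^ 2) - σ ^ 2 / (4 * u ^ 4))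
        + ((1 / (120 * w ^ 4)).re - 1 / (120 * u ^ 4))
        - (1 / ((252 : ℝ) * w ^ 6)).re + (1 / ((240 : ℝ) * w ^ 8)).re
        - (1 / ((132 : ℝ) * w ^ 10)).re := by
    rw [hRre_eq]
    field_simp
    ring
  rw [key]
  have hAle := abs_le.1 hA
  have hFle := abs_le.1 hF
  have hGle := abs_le.1 hG
  have hHle := abs_le.1 hH
  have hRle := abs_le.1 hRre
  have esum : (σ ^ 6 + σ ^ 5 / 2 + (5 * σ ^ 4 + 3 * σ ^ 6) / 12
        + (10 * σ ^ 2 + 5 * σ ^ 4 + 4 * σ ^ 6 + σ ^ 8) / 120 + 1 / 252) / u ^ 6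
        + (1 / 240) / u ^ 8 + (1 / 132 + 51975 / (8 * π ^ 9 * σ)) / u ^ 10 =
      σ ^ 6 / u ^ 6 + σ ^ 5 / 2 / u ^ 6 + (5 * σ ^ 4 + 3 * σ ^ 6) / 12 / u ^ 6
        + (10 * σ ^ 2 + 5 * σ ^ 4 + 4 * σ ^ 6 + σ ^ 8) / 120 / u ^ 6 + 1 / (252 * u ^ 6)
        + 1 / (240 * u ^ 8) + (1 / (132 * u ^ 10) + (51975 / (8 * π ^ 9 * σ)) / u ^ 10) := by
    field_simp
  rw [esum, abs_le]
  constructor <;> linarith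

/-! ### Integrated: `arg Γ(σ+iτ)` to third order -/

/-- **`|arg Γ(σ+iτ) − (τ log τ − τ) − c(σ) + a/τ + b/(3τ³)| ≤ K₆/(5τ⁵) + (1/240)/(7τ⁷) + K₁₀/(9τ⁹)`**
for `0 < σ ≤ ½`, `τ ≥ 1` (`a, b, K₆, K₁₀` as in `abs_re_digamma_vertical_sub_log_sub_sub_le`;
`c(σ) = stirlingArgConst σ`): the tree's identity `E(τ) − c(σ) = −∫_τ^∞ (Re ψ(σ+iu) − log u) du` with
the integrand split as `a/u² + b/u⁴ + r₃(u)`. [cite: AndrewsAskeyRoy1999, Cor 1.4.5] -/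
theorem abs_argGammaVert_sub_stirling_three_le {σ : ℝ} (hσ : 0 < σ) (hσ1 : σ ≤ 1 / 2) {τ : ℝ} (hτ : 1 ≤ τ) :
    |argGammaVert σ τ - (τ * Real.log τ - τ) - stirlingArgConst σ
        + (σ ^ 2 / 2 - σ / 2 + 1 / 12) / τ + (-(σ ^ 4 / 4) + σ ^ 3 / 2 - σ ^ 2 / 4 + 1 / 120) / (3 * τ ^ 3)| ≤
      (σ ^ 6 + σ ^ 5 / 2 + (5 * σ ^ 4 + 3 * σ ^ 6) / 12 + (10 * σ ^ 2 + 5 * σ ^ 4 + 4 * σ ^ 6 + σ ^ 8) / 120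
          + 1 / 252) / (5 * τ ^ 5)
        + (1 / 240) / (7 * τ ^ 7) + (1 / 132 + 51975 / (8 * π ^ 9 * σ)) / (9 * τ ^ 9) := by
  set E : ℝ → ℝ := fun τ ↦ argGammaVert σ τ - (τ * Real.log τ - τ) with hE
  set E' : ℝ → ℝ := fun u ↦ (digamma (σ + u * I)).re - Real.log u with hE'
  set a : ℝ := σ ^ 2 / 2 - σ / 2 + 1 / 12 with ha
  set b : ℝ := -(σ ^ 4 / 4) + σ ^ 3 / 2 - σ ^ 2 / 4 + 1 / 120 with hb
  set K₆ : ℝ := σ ^ 6 + σ ^ 5 / 2 + (5 * σ ^ 4 + 3 * σ ^ 6) / 12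
    + (10 * σ ^ 2 + 5 * σ ^ 4 + 4 * σ ^ 6 + σ ^ 8) / 120 + 1 / 252 with hK₆
  set K₈ : ℝ := 1 / 240 with hK₈
  set K₁₀ : ℝ := 1 / 132 + 51975 / (8 * π ^ 9 * σ) with hK₁₀
  have hτ0 : 0 < τ := by linarith
  have hK₆0 : 0 ≤ K₆ := by positivity
  have hK₈0 : 0 ≤ K₈ := by positivity
  have hK₁₀0 : 0 ≤ K₁₀ := by positivity
  -- FTC on `[1, τ]`
  have hFTC : ∫ u in (1 : ℝ)..τ, E' u = E τ - E 1 := by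
    refine intervalIntegral.integral_eq_sub_of_hasDerivAt (fun u hu ↦ ?_) ?_
    · rw [uIcc_of_le hτ] at hu
      exact hasDerivAt_argGammaVert_sub hσ (by linarith [hu.1])
    · refine ContinuousOn.intervalIntegrable ?_
      rw [uIcc_of_le hτ]
      exact (continuousOn_re_digamma_vertical_sub_log hσ).mono fun u hu ↦ by
        simp only [mem_Ioi]; linarith [hu.1]
  have hI1 := integrableOn_re_digamma_vertical_sub_log (σ := σ) (a := 1) hσ le_rfl
  have hIτ := integrableOn_re_digamma_vertical_sub_log hσ hτ
  have hsplit : ∫ u in Ioi (1 : ℝ), E' u = (∫ u in (1 : ℝ)..τ, E' u) + ∫ u in Ioi τ, E' u := by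
    rw [intervalIntegral.integral_of_le hτ, ← setIntegral_union (Ioc_disjoint_Ioi le_rfl)
      measurableSet_Ioi (hI1.mono_set Ioc_subset_Ioi_self) hIτ, Ioc_union_Ioi_eq_Ioi hτ]
  have hE1 : E 1 = argGammaVert σ 1 + 1 := by simp [hE]
  have hc : stirlingArgConst σ = E 1 + ∫ u in Ioi (1 : ℝ), E' u := by
    rw [stirlingArgConst, hE1]
  have hmain : E τ - stirlingArgConst σ = -∫ u in Ioi τ, E' u := by
    rw [hc, hsplit, hFTC]; ring
  -- the `a/u² + b/u⁴` part
  have hIa : IntegrableOn (fun u : ℝ ↦ a * u ^ (-2 : ℝ)) (Ioi τ) :=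
    (integrableOn_Ioi_rpow_of_lt (by norm_num) hτ0).const_mul _
  have hIb : IntegrableOn (fun u : ℝ ↦ b * u ^ (-4 : ℝ)) (Ioi τ) :=
    (integrableOn_Ioi_rpow_of_lt (by norm_num) hτ0).const_mul _
  have hIa_val : ∫ u in Ioi τ, a * u ^ (-2 : ℝ) = a / τ := by
    rw [MeasureTheory.integral_const_mul, integral_Ioi_rpow_of_lt (by norm_num) hτ0]
    rw [show (-2 : ℝ) + 1 = -1 by norm_num, Real.rpow_neg_one]
    field_simp
  have hIb_val : ∫ u in Ioi τ, b * u ^ (-4 : ℝ) = b / (3 * τ ^ 3) := by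
    rw [MeasureTheory.integral_const_mul, integral_Ioi_rpow_of_lt (by norm_num) hτ0]
    rw [show (-4 : ℝ) + 1 = -3 by norm_num, Real.rpow_neg hτ0.le,
      show (3 : ℝ) = ((3 : ℕ) : ℝ) by norm_num, Real.rpow_natCast]
    field_simp
  have hIab : IntegrableOn (fun u : ℝ ↦ a * u ^ (-2 : ℝ) + b * u ^ (-4 : ℝ)) (Ioi τ) := hIa.add hIb
  have hIr : IntegrableOn (fun u : ℝ ↦ E' u - (a * u ^ (-2 : ℝ) + b * u ^ (-4 : ℝ))) (Ioi τ) :=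
    hIτ.sub hIab
  have hsplit2 : ∫ u in Ioi τ, E' u =
      a / τ + b / (3 * τ ^ 3) + ∫ u in Ioi τ, (E' u - (a * u ^ (-2 : ℝ) + b * u ^ (-4 : ℝ))) := by
    rw [integral_sub hIτ hIab, integral_add hIa hIb, hIa_val, hIb_val]; ring
  -- tail bound for the remainder
  have hg6 : IntegrableOn (fun u : ℝ ↦ K₆ * u ^ (-6 : ℝ)) (Ioi τ) :=
    (integrableOn_Ioi_rpow_of_lt (by norm_num) hτ0).const_mul _
  have hg8 : IntegrableOn (fun u : ℝ ↦ K₈ * u ^ (-8 : ℝ)) (Ioi τ) :=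
    (integrableOn_Ioi_rpow_of_lt (by norm_num) hτ0).const_mul _
  have hg10 : IntegrableOn (fun u : ℝ ↦ K₁₀ * u ^ (-10 : ℝ)) (Ioi τ) :=
    (integrableOn_Ioi_rpow_of_lt (by norm_num) hτ0).const_mul _
  have hg : IntegrableOn (fun u : ℝ ↦ K₆ * u ^ (-6 : ℝ) + K₈ * u ^ (-8 : ℝ) + K₁₀ * u ^ (-10 : ℝ))
      (Ioi τ) := (hg6.add hg8).add hg10
  have hrpow : ∀ (u : ℝ) (k : ℕ), 0 < u → u ^ (-(k : ℝ)) = 1 / u ^ k := by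
    intro u k hu0
    rw [Real.rpow_neg hu0.le, Real.rpow_natCast, one_div]
  have htail : |∫ u in Ioi τ, (E' u - (a * u ^ (-2 : ℝ) + b * u ^ (-4 : ℝ)))| ≤
      K₆ / (5 * τ ^ 5) + K₈ / (7 * τ ^ 7) + K₁₀ / (9 * τ ^ 9) := by
    have hle := MeasureTheory.norm_integral_le_of_norm_le (μ := volume.restrict (Ioi τ))
      (f := fun u : ℝ ↦ E' u - (a * u ^ (-2 : ℝ) + b * u ^ (-4 : ℝ))) hg
      ((ae_restrict_iff' measurableSet_Ioi).2 (Eventually.of_forall fun u hu ↦ by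
        have hu1 : 1 ≤ u := hτ.trans (le_of_lt hu)
        have hu0 : 0 < u := by linarith
        have := abs_re_digamma_vertical_sub_log_sub_sub_le hσ hσ1 hu1
        change ‖E' u - (a * u ^ (-2 : ℝ) + b * u ^ (-4 : ℝ))‖ ≤
          K₆ * u ^ (-6 : ℝ) + K₈ * u ^ (-8 : ℝ) + K₁₀ * u ^ (-10 : ℝ)
        rw [Real.norm_eq_abs]
        have e2 := hrpow u 2 hu0
        have e4 := hrpow u 4 hu0
        have e6 := hrpow u 6 hu0
        have e8 := hrpow u 8 hu0
        have e10 := hrpow u 10 hu0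
        push_cast at e2 e4 e6 e8 e10
        rw [e2, e4, e6, e8, e10]
        have e1 : E' u - (a * (1 / u ^ 2) + b * (1 / u ^ 4)) =
            (digamma (σ + u * I)).re - Real.log u - (σ ^ 2 / 2 - σ / 2 + 1 / 12) / u ^ 2
              - (-(σ ^ 4 / 4) + σ ^ 3 / 2 - σ ^ 2 / 4 + 1 / 120) / u ^ 4 := by
          simp only [hE', ha, hb]
          ring
        rw [e1]
        refine this.trans (le_of_eq ?_)
        rw [hK₆, hK₈, hK₁₀]
        ring))
    rw [Real.norm_eq_abs] at hle
    refine hle.trans (le_of_eq ?_)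
    have hg68 : IntegrableOn (fun u : ℝ ↦ K₆ * u ^ (-6 : ℝ) + K₈ * u ^ (-8 : ℝ)) (Ioi τ) := hg6.add hg8
    have i1 : ∫ u in Ioi τ, (K₆ * u ^ (-6 : ℝ) + K₈ * u ^ (-8 : ℝ) + K₁₀ * u ^ (-10 : ℝ)) =
        (∫ u in Ioi τ, (K₆ * u ^ (-6 : ℝ) + K₈ * u ^ (-8 : ℝ))) + ∫ u in Ioi τ, K₁₀ * u ^ (-10 : ℝ) :=
      integral_add hg68 hg10
    have i2 : ∫ u in Ioi τ, (K₆ * u ^ (-6 : ℝ) + K₈ * u ^ (-8 : ℝ)) =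
        (∫ u in Ioi τ, K₆ * u ^ (-6 : ℝ)) + ∫ u in Ioi τ, K₈ * u ^ (-8 : ℝ) :=
      integral_add hg6 hg8
    rw [i1, i2, MeasureTheory.integral_const_mul,
      MeasureTheory.integral_const_mul, MeasureTheory.integral_const_mul,
      integral_Ioi_rpow_of_lt (by norm_num) hτ0, integral_Ioi_rpow_of_lt (by norm_num) hτ0,
      integral_Ioi_rpow_of_lt (by norm_num) hτ0]
    have e5 := hrpow τ 5 hτ0
    have e7 := hrpow τ 7 hτ0
    have e9 := hrpow τ 9 hτ0
    push_cast at e5 e7 e9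
    rw [show (-6 : ℝ) + 1 = -5 by norm_num, show (-8 : ℝ) + 1 = -7 by norm_num,
      show (-10 : ℝ) + 1 = -9 by norm_num, e5, e7, e9]
    field_simp
  have hgoal : E τ - stirlingArgConst σ + a / τ + b / (3 * τ ^ 3) =
      -∫ u in Ioi τ, (E' u - (a * u ^ (-2 : ℝ) + b * u ^ (-4 : ℝ))) := by
    rw [hmain, hsplit2]; ring
  show |E τ - stirlingArgConst σ + a / τ + b / (3 * τ ^ 3)| ≤ K₆ / (5 * τ ^ 5) + K₈ / (7 * τ ^ 7) + K₁₀ / (9 * τ ^ 9)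
  rw [hgoal, abs_neg]
  exact htail

/-! ### `θ` to third order and Brent–Platt–Trudgian's Lemma 2 -/

/-- The constants at `σ = ¼`: `32K₆(¼)/5 ≤ 0.0754`, `128·(1/240)/7 ≤ 0.0762`, `512K₁₀(¼)/9 ≤ 50.03`. [folklore] -/
private lemma quarter_constants :
    32 * ((1 / 4 : ℝ) ^ 6 + (1 / 4 : ℝ) ^ 5 / 2 + (5 * (1 / 4 : ℝ) ^ 4 + 3 * (1 / 4 : ℝ) ^ 6) / 12
        + (10 * (1 / 4 : ℝ) ^ 2 + 5 * (1 / 4 : ℝ) ^ 4 + 4 * (1 / 4 : ℝ) ^ 6 + (1 / 4 : ℝ) ^ 8) / 120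
        + 1 / 252) / 5 ≤ 0.0754 ∧
      128 * (1 / 240 : ℝ) / 7 ≤ 0.0762 ∧
      512 * (1 / 132 + 51975 / (8 * π ^ 9 * (1 / 4))) / 9 ≤ 50.03 := by
  refine ⟨by norm_num, by norm_num, ?_⟩
  have hπ : 3.14159 < π := by linarith [Real.pi_gt_d6]
  have hπ9 : 29808 < π ^ 9 := by
    have := pow_lt_pow_left₀ hπ (by norm_num : (0 : ℝ) ≤ 3.14159) (by norm_num : (9 : ℕ) ≠ 0)
    norm_num at this
    linarith
  have h1 : 51975 / (8 * π ^ 9 * (1 / 4)) ≤ 51975 / (8 * 29808 * (1 / 4)) := by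
    apply div_le_div_of_nonneg_left (by norm_num) (by norm_num)
    nlinarith
  norm_num at h1 ⊢
  linarith

/-- **Third-order Stirling for `θ`**: for `t ≥ 2`,
`|θ(t) − ((t/2) log(t/2π) − t/2 − π/8 + 1/(48t) + 7/(5760t³))| ≤ 0.0754/t⁵ + 0.0762/t⁷ + 50.03/t⁹`
(`a(¼) = −1/96`, `b(¼) = −7/15360`, `c(¼) = −π/8`, `τ = t/2`). [cite: BrentPlattTrudgian2021, Lemma 2 (proof)] -/
theorem abs_riemannSiegelTheta_sub_stirling_three_le {t : ℝ} (ht : 2 ≤ t) :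
    |riemannSiegelTheta t - (t / 2 * Real.log (t / (2 * π)) - t / 2 - π / 8 + 1 / (48 * t)
        + 7 / (5760 * t ^ 3))| ≤ 0.0754 / t ^ 5 + 0.0762 / t ^ 7 + 50.03 / t ^ 9 := by
  have hτ : 1 ≤ t / 2 := by linarith
  have ht0 : 0 < t := by linarith
  have h := abs_argGammaVert_sub_stirling_three_le (σ := 1 / 4) (by norm_num) (by norm_num) hτ
  rw [stirlingArgConst_one_quarter] at h
  have hlog : Real.log (t / 2) - Real.log π = Real.log (t / (2 * π)) := by
    rw [← Real.log_div (by positivity) Real.pi_ne_zero, div_div]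
  have e : riemannSiegelTheta t - (t / 2 * Real.log (t / (2 * π)) - t / 2 - π / 8 + 1 / (48 * t)
        + 7 / (5760 * t ^ 3)) =
      argGammaVert (1 / 4) (t / 2) - (t / 2 * Real.log (t / 2) - t / 2) - -(π / 8)
        + ((1 / 4 : ℝ) ^ 2 / 2 - 1 / 4 / 2 + 1 / 12) / (t / 2)
        + (-((1 / 4 : ℝ) ^ 4 / 4) + (1 / 4 : ℝ) ^ 3 / 2 - (1 / 4 : ℝ) ^ 2 / 4 + 1 / 120)
          / (3 * (t / 2) ^ 3) := by
    rw [riemannSiegelTheta_eq_argGammaVert, ← hlog]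
    field_simp
    ring
  rw [e]
  refine h.trans ?_
  obtain ⟨c6, c8, c10⟩ := quarter_constants
  have ht5 : 0 < t ^ 5 := by positivity
  have ht7 : 0 < t ^ 7 := by positivity
  have ht9 : 0 < t ^ 9 := by positivity
  set K₆ : ℝ := (1 / 4 : ℝ) ^ 6 + (1 / 4 : ℝ) ^ 5 / 2 + (5 * (1 / 4 : ℝ) ^ 4 + 3 * (1 / 4 : ℝ) ^ 6) / 12
    + (10 * (1 / 4 : ℝ) ^ 2 + 5 * (1 / 4 : ℝ) ^ 4 + 4 * (1 / 4 : ℝ) ^ 6 + (1 / 4 : ℝ) ^ 8) / 120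
    + 1 / 252 with hK₆
  set K₁₀ : ℝ := 1 / 132 + 51975 / (8 * π ^ 9 * (1 / 4)) with hK₁₀
  have hK₆0 : 0 ≤ K₆ := by positivity
  have hK₁₀0 : 0 ≤ K₁₀ := by positivity
  have e6 : K₆ / (5 * (t / 2) ^ 5) = (32 * K₆ / 5) / t ^ 5 := by field_simp; ring
  have e8 : (1 / 240 : ℝ) / (7 * (t / 2) ^ 7) = (128 * (1 / 240 : ℝ) / 7) / t ^ 7 := by field_simp; ring
  have e10 : K₁₀ / (9 * (t / 2) ^ 9) = (512 * K₁₀ / 9) / t ^ 9 := by field_simp; ring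
  rw [e6, e8, e10]
  gcongr

/-- **Brent–Platt–Trudgian 2021, Lemma 2 — DISCHARGED**: `|Q(t) − S(t)| ≤ 1/(150t)` for every `t ≥ 2π`
(`Q = N − L`; `Q − S = (θ − ((t/2)log(t/2π) − t/2 − π/8))/π`): from the third-order bound,
`|θ − main| ≤ 1/(48t) + 7/(5760t³) + 0.0754/t⁵ + 0.0762/t⁷ + 50.03/t⁹ ≤ π/(150t)` on `[2π, ∞)`
(at `t = 2π` the slack is `≈ 10⁻⁵/t`). [cite: BrentPlattTrudgian2021, Lemma 2] -/
theorem BrentPlattTrudgian2021_lemma2_holds : BrentPlattTrudgian2021_lemma2 := by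
  intro t ht
  have hπ : 3.14159 < π := by linarith [Real.pi_gt_d6]
  have hπ' : π < 3.1416 := by linarith [Real.pi_lt_d4]
  have hπ0 := Real.pi_pos
  have ht0 : 0 < t := by linarith
  have ht6 : 6.28318 ≤ t := by linarith
  have h3 := abs_riemannSiegelTheta_sub_stirling_three_le (by linarith : (2 : ℝ) ≤ t)
  have hQS : ((zetaZeroCount t : ℝ) - countMain t) - zetaArgS t =
      (riemannSiegelTheta t - (t / 2 * Real.log (t / (2 * π)) - t / 2 - π / 8)) / π := by
    rw [zetaZeroCount_eq_theta_add_zetaArgS, countMain]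
    field_simp
    ring
  rw [hQS, abs_div, abs_of_pos hπ0, div_le_iff₀ hπ0]
  -- `|θ − main| ≤ 1/(48t) + 7/(5760t³) + 0.0754/t⁵ + 0.0762/t⁷ + 50.03/t⁹`
  have h4 : |riemannSiegelTheta t - (t / 2 * Real.log (t / (2 * π)) - t / 2 - π / 8)| ≤
      1 / (48 * t) + 7 / (5760 * t ^ 3) + (0.0754 / t ^ 5 + 0.0762 / t ^ 7 + 50.03 / t ^ 9) := by
    have e : riemannSiegelTheta t - (t / 2 * Real.log (t / (2 * π)) - t / 2 - π / 8) =
        (riemannSiegelTheta t - (t / 2 * Real.log (t / (2 * π)) - t / 2 - π / 8 + 1 / (48 * t)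
          + 7 / (5760 * t ^ 3))) + (1 / (48 * t) + 7 / (5760 * t ^ 3)) := by ring
    rw [e]
    have hY : |1 / (48 * t) + 7 / (5760 * t ^ 3)| = 1 / (48 * t) + 7 / (5760 * t ^ 3) :=
      abs_of_pos (by positivity)
    have := abs_add_le (riemannSiegelTheta t - (t / 2 * Real.log (t / (2 * π)) - t / 2 - π / 8
      + 1 / (48 * t) + 7 / (5760 * t ^ 3))) (1 / (48 * t) + 7 / (5760 * t ^ 3))
    rw [hY] at this
    linarith [h3]
  refine h4.trans ?_
  -- each term `c/tᵏ = (c/t^{k−1})·(1/t) ≤ (c/(2π)^{k−1})·(1/t)`, then the numerical inequality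
  have ht2 : 39.478 ≤ t ^ 2 := by nlinarith
  have ht4 : 1558.5 ≤ t ^ 4 := by nlinarith
  have ht6' : 61520 ≤ t ^ 6 := by nlinarith
  have ht8 : 2428900 ≤ t ^ 8 := by nlinarith
  have k3 : 7 / (5760 * t ^ 3) ≤ 7 / (5760 * 39.478) / t := by
    rw [div_div, div_le_div_iff_of_pos_left (by norm_num) (by positivity) (by positivity)]
    nlinarith
  have k5 : 0.0754 / t ^ 5 ≤ 0.0754 / 1558.5 / t := by
    rw [div_div, div_le_div_iff_of_pos_left (by norm_num) (by positivity) (by positivity)]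
    nlinarith
  have k7 : 0.0762 / t ^ 7 ≤ 0.0762 / 61520 / t := by
    rw [div_div, div_le_div_iff_of_pos_left (by norm_num) (by positivity) (by positivity)]
    nlinarith
  have k9 : 50.03 / t ^ 9 ≤ 50.03 / 2428900 / t := by
    rw [div_div, div_le_div_iff_of_pos_left (by norm_num) (by positivity) (by positivity)]
    nlinarith
  have k1 : 1 / (48 * t) = (1 / 48) / t := by rw [div_div]
  have hsum : (1 / 48 : ℝ) + 7 / (5760 * 39.478) + 0.0754 / 1558.5 + 0.0762 / 61520 + 50.03 / 2428900
      ≤ 3.14159 / 150 := by norm_num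
  have hfin : ((1 / 48 : ℝ) + 7 / (5760 * 39.478) + 0.0754 / 1558.5 + 0.0762 / 61520 + 50.03 / 2428900) / t
      ≤ 1 / (150 * t) * π := by
    rw [div_le_iff₀ ht0]
    have e : 1 / (150 * t) * π * t = π / 150 := by field_simp
    rw [e]
    linarith
  have esplit : ((1 / 48 : ℝ) + 7 / (5760 * 39.478) + 0.0754 / 1558.5 + 0.0762 / 61520 + 50.03 / 2428900) / t
      = (1 / 48) / t + 7 / (5760 * 39.478) / t + 0.0754 / 1558.5 / t + 0.0762 / 61520 / t
        + 50.03 / 2428900 / t := by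
    field_simp
  rw [esplit] at hfin
  linarith

end Literature.NumberTheory.LFunctions
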